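import Mathlib
import Summits.CriticalPhenomena.SAWScalingLimit.Theses.SAWDevelopingMap
import Literature.Probability.RandomPlanarGeometry.LocalMartingaleProofs

/-!
# Endpoint necessity for the conclusion of crux `ObservableToSLE` (stmt-CriticalPhenomena-10472)

Negative/tightness lemmas (refuter, cdisprove gen 2): the conclusion
`ConvergesInLawToSLE κ D (curve) (hexSAWLaw)` of the crux FORCES every field of its own hypothesis
structure `IsEmbEndpointApprox` (eventual reachability; `δ·a_δ → a`; `δ·b_δ → b`), so the typed
conclusion (= item `HexConjecture`, DCS Conjecture 1) says exactly that the necessary condition is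
sufficient; and the conclusion with `reachable`, resp. the two `tendsto` fields, dropped is FALSE.
-/

noncomputable section

open Literature.Probability.RandomPlanarGeometry Literature.Probability.RandomPlanarGeometry.SAW
  Literature.Probability.LatticeModels Literature.Probability MeasureTheory Filter Topology Set
open scoped NNReal ENNReal BoundedContinuousFunction

namespace Summit.CriticalPhenomena.SAWScalingLimit.Theorems.ObservableToSLE.Negative

open Summit.CriticalPhenomena.SAWScalingLimit.Theses

variable {κ : ℝ≥0} {D : DobrushinDomain} {a b : ℝ → HexVertex} {Γ : (ℝ≥0 → ℝ) → CurveClass ℂ}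

/-- `0` lies in the closure of the open upper half-plane. [folklore] -/
theorem zero_mem_closure_upperHalfPlaneSet' :
    (0 : ℂ) ∈ closure UpperHalfPlane.upperHalfPlaneSet := by
  have ht : Tendsto (fun t : ℝ => (t : ℂ) * Complex.I) (𝓝[>] 0) (𝓝 0) := by
    have : Tendsto (fun t : ℝ => (t : ℂ) * Complex.I) (𝓝 0) (𝓝 (((0 : ℝ) : ℂ) * Complex.I)) :=
      ((Complex.continuous_ofReal.mul continuous_const).tendsto 0)
    simpa using this.mono_left nhdsWithin_le_nhds
  refine mem_closure_of_tendsto ht ?_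
  filter_upwards [self_mem_nhdsWithin] with t ht
  show 0 < ((t : ℂ) * Complex.I).im
  simpa using ht

/-- The source of a chordal SLE_κ random curve class in `(D; a, b)` is a.s. `D.pt 0`. [folklore] -/
theorem source_ae_eq_pt_zero_of_isSLECurve (hΓ : IsSLECurve κ D Γ) :
    ∀ᵐ ω ∂Process.preWienerMeasure, (Γ ω).source = D.pt 0 := by
  obtain ⟨-, φ, hφ, hae⟩ := hΓ
  filter_upwards [hae] with ω hω
  obtain ⟨hgen, c, hc, himg⟩ := hω
  have h0 : c 0 = φ.boundaryExtension (sleTrace κ ω (rayParam 0)) := himg.1 0 (by simp)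
  rw [hc, CurveClass.source_mk, Curve.source, h0, rayParam_zero, hgen.apply_zero, sleDriving_zero,
    Complex.ofReal_zero]
  exact φ.boundaryExtension_eq_of_hasBoundaryValue zero_mem_closure_upperHalfPlaneSet' hφ.1

/-- The target of a chordal SLE_κ random curve class in `(D; a, b)` is a.s. `D.pt 1`. [folklore] -/
theorem target_ae_eq_pt_one_of_isSLECurve (hΓ : IsSLECurve κ D Γ) :
    ∀ᵐ ω ∂Process.preWienerMeasure, (Γ ω).target = D.pt 1 := by
  obtain ⟨-, φ, -, hae⟩ := hΓ
  filter_upwards [hae] with ω hω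
  obtain ⟨-, c, hc, himg⟩ := hω
  rw [hc, CurveClass.target_mk, Curve.target]
  exact himg.2

/-- A walk's polyline ends at the embedded final vertex. [folklore] -/
theorem walk_toCurve_apply_one {V E : Type*} [AddCommGroup E] [Module ℝ E] [TopologicalSpace E]
    [ContinuousAdd E] [ContinuousSMul ℝ E] {G : SimpleGraph V} {u v : V} (emb : V → E)
    (w : G.Walk u v) : w.toCurve emb 1 = emb v := by
  have hs : w.support.map emb = emb u :: w.support.tail.map emb := by
    rw [← w.cons_tail_support, List.map_cons, List.tail_cons]
  have hlast : (emb u :: w.support.tail.map emb).getLast (by simp) = emb v := by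
    have h1 : (w.support.map emb).getLast (by simp) = emb v := by
      rw [List.getLast_map, SimpleGraph.Walk.getLast_support]
    simpa only [hs] using h1
  change polyline (w.support.map emb) 1 = emb v
  rw [hs, polyline_apply_one, hlast]

/-- The hexagonal SAW polyline class starts at `δ · a`. [folklore] -/
theorem source_hexCurve {Ω : Set ℂ} (δ : ℝ) {u v : HexVertex} (γ : HexDomainSAW Ω δ u v) :
    γ.curve.source = (δ : ℂ) * hexCenter u := by
  change (γ.walk.toCurve fun w => (δ : ℂ) * hexCenter w) 0 = _
  exact SimpleGraph.Walk.toCurve_apply_zero _ _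

/-- The hexagonal SAW polyline class ends at `δ · b`. [folklore] -/
theorem target_hexCurve {Ω : Set ℂ} (δ : ℝ) {u v : HexVertex} (γ : HexDomainSAW Ω δ u v) :
    γ.curve.target = (δ : ℂ) * hexCenter v := by
  change (γ.walk.toCurve fun w => (δ : ℂ) * hexCenter w) 1 = _
  exact walk_toCurve_apply_one _ _

/-- A bounded continuous test function: truncated distance of a continuous functional to a point. [folklore] -/
theorem exists_truncDist (F : CurveClass ℂ → ℂ) (hF : Continuous F) (p : ℂ) :
    ∃ f : CurveClass ℂ →ᵇ ℝ, ∀ c, f c = min (dist (F c) p) 1 := by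
  refine ⟨BoundedContinuousFunction.mkOfBound
    ⟨fun c => min (dist (F c) p) 1, (hF.dist continuous_const).min continuous_const⟩ 1 ?_, fun c => rfl⟩
  intro x y
  simp only [ContinuousMap.coe_mk, Real.dist_eq]
  have hx0 : 0 ≤ min (dist (F x) p) 1 := le_min dist_nonneg zero_le_one
  have hy0 : 0 ≤ min (dist (F y) p) 1 := le_min dist_nonneg zero_le_one
  have hx1 : min (dist (F x) p) 1 ≤ 1 := min_le_right _ _
  have hy1 : min (dist (F y) p) 1 ≤ 1 := min_le_right _ _
  rw [abs_sub_le_iff]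
  constructor <;> linarith

/-- MASS: under the conclusion the total mass of the SAW law tends to `1`. [folklore] -/
theorem tendsto_real_univ_of_convergesInLawToSLE
    (h : ConvergesInLawToSLE κ D (fun δ (γ : HexDomainSAW D.carrier δ (a δ) (b δ)) => γ.curve)
      (fun δ => hexSAWLaw D.carrier δ (a δ) (b δ))) :
    Tendsto (fun δ => (hexSAWLaw D.carrier δ (a δ) (b δ)).real univ) (𝓝[>] (0 : ℝ)) (𝓝 1) := by
  obtain ⟨Γ, -, -, hT⟩ := h
  haveI := isProbabilityMeasure_preWienerMeasure'
  have h1 := hT (BoundedContinuousFunction.const (CurveClass ℂ) (1 : ℝ))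
  simpa [integral_const] using h1

/-- NECESSITY OF `reachable`: under the conclusion `a_δ`, `b_δ` are eventually joined in `Ω_δ`
(an empty SAW space has law `0`, whose mass cannot tend to `1`). [folklore] -/
theorem eventually_reachable_of_convergesInLawToSLE
    (h : ConvergesInLawToSLE κ D (fun δ (γ : HexDomainSAW D.carrier δ (a δ) (b δ)) => γ.curve)
      (fun δ => hexSAWLaw D.carrier δ (a δ) (b δ))) :
    ∀ᶠ δ in 𝓝[>] (0 : ℝ), (hexDomainGraph D.carrier δ).Reachable (a δ) (b δ) := by
  have h2 : ∀ᶠ δ in 𝓝[>] (0 : ℝ), (1 / 2 : ℝ) < (hexSAWLaw D.carrier δ (a δ) (b δ)).real univ :=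
    (tendsto_real_univ_of_convergesInLawToSLE h).eventually (lt_mem_nhds (by norm_num))
  filter_upwards [h2] with δ hδ
  by_contra hr
  haveI : IsEmpty (HexDomainSAW D.carrier δ (a δ) (b δ)) := ⟨fun γ => hr ⟨γ.walk⟩⟩
  have h0 : hexSAWLaw D.carrier δ (a δ) (b δ) = 0 := Measure.eq_zero_of_isEmpty _
  rw [h0] at hδ
  simp at hδ
  linarith

/-- Squeeze: `mass → 1` and `mass * m → 0` give `m → 0`. [folklore] -/
theorem tendsto_of_mul_mass {mass m : ℝ → ℝ} (hmass : Tendsto mass (𝓝[>] (0 : ℝ)) (𝓝 1))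
    (hprod : Tendsto (fun δ => mass δ * m δ) (𝓝[>] (0 : ℝ)) (𝓝 0)) :
    Tendsto m (𝓝[>] (0 : ℝ)) (𝓝 0) := by
  have hdiv := hprod.div hmass one_ne_zero
  rw [zero_div] at hdiv
  apply hdiv.congr'
  filter_upwards [hmass.eventually (lt_mem_nhds one_half_lt_one)] with δ hδ
  have hne : mass δ ≠ 0 := by intro h0; rw [h0] at hδ; norm_num at hδ
  simp only [Pi.div_apply]
  field_simp

/-- From `min (dist (f δ) p) 1 → 0` to `f δ → p`. [folklore] -/
theorem tendsto_of_tendsto_min_dist {f : ℝ → ℂ} {p : ℂ}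
    (h : Tendsto (fun δ => min (dist (f δ) p) 1) (𝓝[>] (0 : ℝ)) (𝓝 0)) :
    Tendsto f (𝓝[>] (0 : ℝ)) (𝓝 p) := by
  rw [tendsto_iff_dist_tendsto_zero]
  apply h.congr'
  filter_upwards [h.eventually (gt_mem_nhds one_pos)] with δ hδ
  exact min_eq_left ((min_lt_iff.1 hδ).resolve_right (lt_irrefl _)).le

/-- NECESSITY OF `tendsto_fst`: under the conclusion, `δ · a_δ → a = D.pt 0`. [folklore] -/
theorem tendsto_fst_of_convergesInLawToSLE
    (h : ConvergesInLawToSLE κ D (fun δ (γ : HexDomainSAW D.carrier δ (a δ) (b δ)) => γ.curve)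
      (fun δ => hexSAWLaw D.carrier δ (a δ) (b δ))) :
    Tendsto (fun δ : ℝ => (δ : ℂ) * hexCenter (a δ)) (𝓝[>] (0 : ℝ)) (𝓝 (D.pt 0)) := by
  have hmass := tendsto_real_univ_of_convergesInLawToSLE h
  obtain ⟨Γ, hΓ, -, hT⟩ := h
  obtain ⟨g, hg⟩ := exists_truncDist CurveClass.source CurveClass.continuous_source (D.pt 0)
  have h1 := hT g
  have hR : ∫ ω, g (Γ ω) ∂Process.preWienerMeasure = 0 := by
    apply integral_eq_zero_of_ae
    filter_upwards [source_ae_eq_pt_zero_of_isSLECurve hΓ] with ω hω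
    simp [hg, hω]
  have hL : ∀ δ, ∫ γ, g ((fun δ (γ : HexDomainSAW D.carrier δ (a δ) (b δ)) => γ.curve) δ γ)
      ∂hexSAWLaw D.carrier δ (a δ) (b δ)
      = (hexSAWLaw D.carrier δ (a δ) (b δ)).real univ *
          min (dist ((δ : ℂ) * hexCenter (a δ)) (D.pt 0)) 1 := by
    intro δ
    simp only [hg, source_hexCurve, integral_const, smul_eq_mul]
  rw [hR] at h1
  simp_rw [hL] at h1
  exact tendsto_of_tendsto_min_dist (tendsto_of_mul_mass hmass h1)

/-- NECESSITY OF `tendsto_snd`: under the conclusion, `δ · b_δ → b = D.pt 1`. [folklore] -/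
theorem tendsto_snd_of_convergesInLawToSLE
    (h : ConvergesInLawToSLE κ D (fun δ (γ : HexDomainSAW D.carrier δ (a δ) (b δ)) => γ.curve)
      (fun δ => hexSAWLaw D.carrier δ (a δ) (b δ))) :
    Tendsto (fun δ : ℝ => (δ : ℂ) * hexCenter (b δ)) (𝓝[>] (0 : ℝ)) (𝓝 (D.pt 1)) := by
  have hmass := tendsto_real_univ_of_convergesInLawToSLE h
  obtain ⟨Γ, hΓ, -, hT⟩ := h
  obtain ⟨g, hg⟩ := exists_truncDist CurveClass.target CurveClass.continuous_target (D.pt 1)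
  have h1 := hT g
  have hR : ∫ ω, g (Γ ω) ∂Process.preWienerMeasure = 0 := by
    apply integral_eq_zero_of_ae
    filter_upwards [target_ae_eq_pt_one_of_isSLECurve hΓ] with ω hω
    simp [hg, hω]
  have hL : ∀ δ, ∫ γ, g ((fun δ (γ : HexDomainSAW D.carrier δ (a δ) (b δ)) => γ.curve) δ γ)
      ∂hexSAWLaw D.carrier δ (a δ) (b δ)
      = (hexSAWLaw D.carrier δ (a δ) (b δ)).real univ *
          min (dist ((δ : ℂ) * hexCenter (b δ)) (D.pt 1)) 1 := by
    intro δ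
    simp only [hg, target_hexCurve, integral_const, smul_eq_mul]
  rw [hR] at h1
  simp_rw [hL] at h1
  exact tendsto_of_tendsto_min_dist (tendsto_of_mul_mass hmass h1)

/-- NECESSITY, packaged: the conclusion of the crux implies its own hypothesis structure
`IsEmbEndpointApprox`, for every `κ`. [folklore] -/
theorem isEmbEndpointApprox_of_convergesInLawToSLE
    (h : ConvergesInLawToSLE κ D (fun δ (γ : HexDomainSAW D.carrier δ (a δ) (b δ)) => γ.curve)
      (fun δ => hexSAWLaw D.carrier δ (a δ) (b δ))) :
    IsEmbEndpointApprox hexGraph hexCenter D a b :=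
  ⟨eventually_reachable_of_convergesInLawToSLE h, tendsto_fst_of_convergesInLawToSLE h,
    tendsto_snd_of_convergesInLawToSLE h⟩

/-- TIGHTNESS OF THE TYPING: the crux's conclusion (item `HexConjecture`) says precisely that the
proved necessary condition `IsEmbEndpointApprox` is also sufficient. [folklore] -/
theorem hexConjecture_iff_endpoint_characterisation :
    SAWDevelopingMap.HexConjecture ↔ ∀ (D : DobrushinDomain) (a b : ℝ → HexVertex),
      (IsEmbEndpointApprox hexGraph hexCenter D a b ↔
        ConvergesInLawToSLE ((8 : ℝ≥0) / 3) D
          (fun δ (γ : HexDomainSAW D.carrier δ (a δ) (b δ)) => γ.curve)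
          (fun δ => hexSAWLaw D.carrier δ (a δ) (b δ))) :=
  ⟨fun h D a b => ⟨h D a b, isEmbEndpointApprox_of_convergesInLawToSLE⟩,
    fun h D a b hab => (h D a b).1 hab⟩

/-- LOAD-BEARING `tendsto`: the conclusion with the two `tendsto` fields of `IsEmbEndpointApprox`
dropped is FALSE — constant coincident endpoints are reachable (trivial walk) but would have to
converge to the two distinct marked points at once. [folklore] -/
theorem hexConjecture_false_without_tendsto :
    ¬ ∀ (D : DobrushinDomain) (a b : ℝ → HexVertex),
      (∀ᶠ δ in 𝓝[>] (0 : ℝ), (hexDomainGraph D.carrier δ).Reachable (a δ) (b δ)) →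
        ConvergesInLawToSLE ((8 : ℝ≥0) / 3) D
          (fun δ (γ : HexDomainSAW D.carrier δ (a δ) (b δ)) => γ.curve)
          (fun δ => hexSAWLaw D.carrier δ (a δ) (b δ)) := by
  intro h
  obtain ⟨D⟩ := (inferInstance : Nonempty DobrushinDomain)
  let v : HexVertex := ((0 : Site 2), (0 : Fin 2))
  have hc := h D (fun _ => v) (fun _ => v) (Eventually.of_forall fun δ => SimpleGraph.Reachable.refl _)
  have h0 := tendsto_fst_of_convergesInLawToSLE hc
  have h1 := tendsto_snd_of_convergesInLawToSLE hc
  have : D.pt 0 = D.pt 1 := tendsto_nhds_unique h0 h1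
  exact absurd (D.pt_injective this) (by decide)

/-- In `Ω_δ` a vertex whose rescaled centre is outside `Ω` reaches only itself. [folklore] -/
theorem eq_of_reachable_of_not_mem {Ω : Set ℂ} {δ : ℝ} {u v : HexVertex}
    (hu : (δ : ℂ) * hexCenter u ∉ Ω) (h : (hexDomainGraph Ω δ).Reachable u v) : u = v := by
  obtain ⟨p⟩ := h
  cases p with
  | nil => rfl
  | cons hadj _ =>
    exact absurd (embMeshDomain_subset hexGraph hexCenter Ω δ
      ((embDomainGraph_adj_iff hexGraph hexCenter).1 hadj).2.1) hu

/-- Real part of the honeycomb vertex `(x, 0)`: `x₀ + x₁/2 + 1/2`. [folklore] -/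
theorem hexCenter_up_re (x : Site 2) :
    (hexCenter (x, (0 : Fin 2))).re = x 0 + (x 1 : ℝ) / 2 + 1 / 2 := by
  have hz : triZeta.re = 1 / 2 := by
    rw [triZeta, Complex.exp_re]
    simp [Real.cos_pi_div_three]
  have hzi : (triZeta).im = Real.sqrt 3 / 2 := by
    rw [triZeta, Complex.exp_im]
    simp [Real.sin_pi_div_three]
  simp [hexCenter, triEmbed, hz, hzi]
  ring

/-- The rescaled up-face of the cell `(n, 0)` is `δ n + δ (1 + ζ)/3`. [folklore] -/
theorem smul_hexCenter_cell (δ : ℝ) (n : ℤ) :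
    (δ : ℂ) * hexCenter ((![n, 0] : Site 2), (0 : Fin 2)) =
      ((δ * n : ℝ) : ℂ) + (δ : ℂ) * ((1 + triZeta) / 3) := by
  simp [hexCenter, triEmbed]
  ring

/-- Its real part is `δ (n + 1/2)`. [folklore] -/
theorem smul_hexCenter_cell_re (δ : ℝ) (n : ℤ) :
    ((δ : ℂ) * hexCenter ((![n, 0] : Site 2), (0 : Fin 2))).re = δ * (n + 1 / 2) := by
  rw [Complex.re_ofReal_mul, hexCenter_up_re]
  simp

/-- `δ ⌈δ⁻¹⌉ → 1` as `δ → 0⁺`. [folklore] -/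
theorem tendsto_mul_ceil_inv :
    Tendsto (fun δ : ℝ => δ * ((⌈δ⁻¹⌉ : ℤ) : ℝ)) (𝓝[>] (0 : ℝ)) (𝓝 1) := by
  have hlo : ∀ᶠ δ in 𝓝[>] (0 : ℝ), (1 : ℝ) ≤ δ * ((⌈δ⁻¹⌉ : ℤ) : ℝ) := by
    filter_upwards [self_mem_nhdsWithin] with δ (hδ : 0 < δ)
    calc (1 : ℝ) = δ * δ⁻¹ := by field_simp
      _ ≤ δ * ((⌈δ⁻¹⌉ : ℤ) : ℝ) := mul_le_mul_of_nonneg_left (Int.le_ceil _) hδ.le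
  have hhi : ∀ᶠ δ in 𝓝[>] (0 : ℝ), δ * ((⌈δ⁻¹⌉ : ℤ) : ℝ) ≤ 1 + δ := by
    filter_upwards [self_mem_nhdsWithin] with δ (hδ : 0 < δ)
    have := (Int.ceil_lt_add_one (δ⁻¹)).le
    calc δ * ((⌈δ⁻¹⌉ : ℤ) : ℝ) ≤ δ * (δ⁻¹ + 1) := mul_le_mul_of_nonneg_left this hδ.le
      _ = 1 + δ := by field_simp
  have h1 : Tendsto (fun δ : ℝ => 1 + δ) (𝓝[>] (0 : ℝ)) (𝓝 1) := by
    have : Tendsto (fun δ : ℝ => 1 + δ) (𝓝 0) (𝓝 (1 + 0)) := tendsto_const_nhds.add tendsto_id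
    simpa using this.mono_left nhdsWithin_le_nhds
  exact tendsto_of_tendsto_of_tendsto_of_le_of_le' tendsto_const_nhds h1 hlo hhi

/-- `δ · (1 + ζ)/3 → 0`. [folklore] -/
theorem tendsto_smul_offset :
    Tendsto (fun δ : ℝ => (δ : ℂ) * ((1 + triZeta) / 3)) (𝓝[>] (0 : ℝ)) (𝓝 0) := by
  have : Tendsto (fun δ : ℝ => (δ : ℂ) * ((1 + triZeta) / 3)) (𝓝 0)
      (𝓝 (((0 : ℝ) : ℂ) * ((1 + triZeta) / 3))) :=
    ((Complex.continuous_ofReal.mul continuous_const).tendsto 0)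
  simpa using this.mono_left nhdsWithin_le_nhds

/-- The rescaled cell `⌈δ⁻¹⌉` tends to `1`. [folklore] -/
theorem tendsto_cell_one :
    Tendsto (fun δ : ℝ => (δ : ℂ) * hexCenter ((![⌈δ⁻¹⌉, 0] : Site 2), (0 : Fin 2)))
      (𝓝[>] (0 : ℝ)) (𝓝 1) := by
  simp_rw [smul_hexCenter_cell]
  have h1 : Tendsto (fun δ : ℝ => ((δ * (⌈δ⁻¹⌉ : ℤ) : ℝ) : ℂ)) (𝓝[>] (0 : ℝ)) (𝓝 ((1 : ℝ) : ℂ)) :=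
    (Complex.continuous_ofReal.tendsto 1).comp (by simpa using tendsto_mul_ceil_inv)
  simpa using h1.add tendsto_smul_offset

/-- The mirrored rescaled cell `-⌈δ⁻¹⌉ - 1` tends to `-1`. [folklore] -/
theorem tendsto_cell_neg_one :
    Tendsto (fun δ : ℝ => (δ : ℂ) * hexCenter ((![-⌈δ⁻¹⌉ - 1, 0] : Site 2), (0 : Fin 2)))
      (𝓝[>] (0 : ℝ)) (𝓝 (-1)) := by
  simp_rw [smul_hexCenter_cell]
  have h1 : Tendsto (fun δ : ℝ => ((δ * ((-⌈δ⁻¹⌉ - 1 : ℤ) : ℝ) : ℝ) : ℂ)) (𝓝[>] (0 : ℝ))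
      (𝓝 ((-1 : ℝ) : ℂ)) := by
    refine (Complex.continuous_ofReal.tendsto (-1)).comp ?_
    have h0 : Tendsto (fun δ : ℝ => δ) (𝓝[>] (0 : ℝ)) (𝓝 0) :=
      tendsto_id.mono_left nhdsWithin_le_nhds
    have := (tendsto_mul_ceil_inv.neg).sub h0
    simp only [sub_zero] at this
    refine this.congr' (Eventually.of_forall fun δ => ?_)
    push_cast
    ring
  simpa using h1.add tendsto_smul_offset

/-- For `δ > 0` the rescaled cell `⌈δ⁻¹⌉` lies outside the open unit disc. [folklore] -/
theorem cell_not_mem_ball {δ : ℝ} (hδ : 0 < δ) :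
    (δ : ℂ) * hexCenter ((![⌈δ⁻¹⌉, 0] : Site 2), (0 : Fin 2)) ∉ Metric.ball (0 : ℂ) 1 := by
  intro h
  rw [Metric.mem_ball, dist_zero_right] at h
  have hre := Complex.abs_re_le_norm ((δ : ℂ) * hexCenter ((![⌈δ⁻¹⌉, 0] : Site 2), (0 : Fin 2)))
  rw [smul_hexCenter_cell_re] at hre
  have h1 : (1 : ℝ) ≤ δ * ((⌈δ⁻¹⌉ : ℤ) + 1 / 2) := by
    have hc : δ⁻¹ ≤ (⌈δ⁻¹⌉ : ℤ) := Int.le_ceil _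
    calc (1 : ℝ) = δ * δ⁻¹ := by field_simp
      _ ≤ δ * ((⌈δ⁻¹⌉ : ℤ) + 1 / 2) := mul_le_mul_of_nonneg_left (by linarith) hδ.le
  have : (1 : ℝ) ≤ |δ * ((⌈δ⁻¹⌉ : ℤ) + 1 / 2)| := h1.trans (le_abs_self _)
  linarith

/-- LOAD-BEARING `reachable`: the conclusion with the `reachable` field of `IsEmbEndpointApprox`
dropped is FALSE — on the unit disc the cells `⌈δ⁻¹⌉ → 1`, `-⌈δ⁻¹⌉-1 → -1` approach the marked
points from OUTSIDE, the first is isolated in `Ω_δ`, so the SAW space is empty. [folklore] -/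
theorem hexConjecture_false_without_reachable :
    ¬ ∀ (D : DobrushinDomain) (a b : ℝ → HexVertex),
      Tendsto (fun δ : ℝ => (δ : ℂ) * hexCenter (a δ)) (𝓝[>] (0 : ℝ)) (𝓝 (D.pt 0)) →
      Tendsto (fun δ : ℝ => (δ : ℂ) * hexCenter (b δ)) (𝓝[>] (0 : ℝ)) (𝓝 (D.pt 1)) →
        ConvergesInLawToSLE ((8 : ℝ≥0) / 3) D
          (fun δ (γ : HexDomainSAW D.carrier δ (a δ) (b δ)) => γ.curve)
          (fun δ => hexSAWLaw D.carrier δ (a δ) (b δ)) := by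
  intro h
  have unitDisc_pt_zero : DobrushinDomain.unitDisc.pt 0 = 1 := by
    simp [MarkedDomain.pt, DobrushinDomain.unitDisc, JordanDomain.unitDisc, circleMap]
  have unitDisc_pt_one : DobrushinDomain.unitDisc.pt 1 = -1 := by
    change circleMap 0 1 (2 * Real.pi * ((![0, 1 / 2] : Fin 2 → ℝ) 1)) = -1
    have : (2 * Real.pi * ((![0, 1 / 2] : Fin 2 → ℝ) 1)) = Real.pi := by simp; ring
    rw [this]
    simp [circleMap, Complex.exp_pi_mul_I]
  have hc := h DobrushinDomain.unitDisc (fun δ => ((![⌈δ⁻¹⌉, 0] : Site 2), (0 : Fin 2)))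
    (fun δ => ((![-⌈δ⁻¹⌉ - 1, 0] : Site 2), (0 : Fin 2)))
    (by simpa [unitDisc_pt_zero] using tendsto_cell_one)
    (by simpa [unitDisc_pt_one] using tendsto_cell_neg_one)
  have hr := eventually_reachable_of_convergesInLawToSLE hc
  have hδ : ∀ᶠ δ in 𝓝[>] (0 : ℝ), 0 < δ := self_mem_nhdsWithin
  obtain ⟨δ, hreach, hpos⟩ := (hr.and hδ).exists
  have heq := eq_of_reachable_of_not_mem (Ω := DobrushinDomain.unitDisc.carrier)
    (by simpa [DobrushinDomain.unitDisc] using cell_not_mem_ball hpos) hreach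
  have : (⌈δ⁻¹⌉ : ℤ) = -⌈δ⁻¹⌉ - 1 := by
    have := congrArg (fun v : HexVertex => v.1 0) heq
    simpa using this
  have : (0 : ℤ) < ⌈δ⁻¹⌉ := Int.ceil_pos.2 (inv_pos.2 hpos)
  omega

end Summit.CriticalPhenomena.SAWScalingLimit.Theorems.ObservableToSLE.Negative
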